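import Literature.AlgebraicGeometry.Resolution.BlowupSNC
import HarnessLib

/-!
# Chart data of a blow-up from a given labelled regular system of parameters

Topic: `Literature/AlgebraicGeometry/Resolution`. A companion to `exists_chartData` of
`BlowupSNC.lean` (Kollár 2007, Def. 3.25; Stacks Project, Tag 0804). There, at a point `x'` of a
blow-up `π : X' → X` along `C` lying over `x = π x' ∈ V(C)`, the chart data `ChartData π C x'`
(an affine open `U ∋ x` on which `C` is generated by a quasi-regular sequence `x_1, …, x_r`
whose germs together with the germs of `w_1, …, w_a` form a regular system of parameters of
`𝒪_{X,x}`, and an affine chart `V ∋ x'` of the blow-up at some `x_i`) are produced from the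
regular system of parameters at `x` hidden in the hypothesis `HasSNCWith E C`, and only the
labels of the old divisors are remembered.

This file proves the same construction starting from a GIVEN regular system of parameters
`u₀ : Fin d → 𝒪_{X,x}` (`d = emb dim`) and a GIVEN set `S₀ ⊆ Fin d` of positions generating the
stalk `C_x`, and RETURNS the identification of the given parameters with the chart sections:

* `exists_chartData_of_rsop` — **equivalence form**: there are chart data `D` and bijections
  `eS : S₀ ≃ Fin D.r`, `eW : S₀ᶜ ≃ Fin D.a` such that `u₀ t` is associated (in `𝒪_{X,x}`) to the
  germ of `D.x (eS t)` for `t ∈ S₀` and to the germ of `D.w (eW t)` for `t ∉ S₀`;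
* `exists_chartData_of_rsop'` — **enumeration form**: the same with injective enumerations
  `σ : Fin D.r → Fin d` of `S₀` and `σ' : Fin D.a → Fin d` of its complement, `u₀ (σ l)` being
  associated to the germ of `D.x l` and `u₀ (σ' m)` to the germ of `D.w m`;
* `exists_chartData_labels_of_rsop` — the conclusion shape of `exists_chartData` recovered: any
  injectively labelled family of ideal sheaves whose stalks at `x` are generated by single
  parameters `u₀ (lab k)` gets an injective assignment of a generator `x_j` or `w_m` whose germ
  generates its stalk.

Proof: that of `exists_chartData` — the `u₀ t` are replaced by associated germs of sections
over one affine open (`exists_sections_associated`); the part indexed by `S₀` is spread out to a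
quasi-regular sequence generating `C` on a basic open (`exists_basicOpen_span_eq_isQuasiRegular`);
the chart is `IsBlowup.exists_generator_chart`; the enumerations are `S₀.equivFin`,
`S₀ᶜ.equivFin`, and the associatedness is that of `exists_sections_associated` transported
along `germ_res_apply`.

## Sources

* J. Kollár, *Lectures on Resolution of Singularities*, Ann. of Math. Stud. 166 (2007),
  Def. 3.24, Def. 3.25. [Kollar2007]
* The Stacks Project, Tag 0804 (affine charts of blow-ups). [StacksProject]

Design: the hypothesis `hxC : π x' ∈ C.support` is implied by `hS₀` (a stalk generated by
parameters is proper); it is kept so that the lemmas are called like `exists_chartData` and the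
`ChartData` API (`stalkIdeal_exceptional`, `exists_rsop`, …), which take it. Not here: any
statement about the boundary `E` beyond the label corollary (see `BlowupSNC.lean`).
-/

noncomputable section

open CategoryTheory CategoryTheory.Limits AlgebraicGeometry TopologicalSpace IsLocalRing

namespace Literature.AlgebraicGeometry.Resolution

universe u v

variable {X X' : Scheme.{u}} [IsLocallyNoetherian X] {π : X' ⟶ X} {C : X.IdealSheafData}

/-- **Chart data from a given regular system of parameters (equivalence form).** Let
`π : X' → X` be a blow-up along `C` of the locally Noetherian scheme `X`, `x' ∈ X'` with
`x = π x'`, `𝒪_{X,x}` regular with minimal basis `u₀ : Fin d → 𝔪_x` (`d = emb dim`), and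
`C_x = (u₀ t : t ∈ S₀)`. Then there are chart data `D : ChartData π C x'` and bijections
`eS : S₀ ≃ Fin D.r`, `eW : S₀ᶜ ≃ Fin D.a` (`S₀ᶜ` the complement in `Fin d`, both finsets coerced
to types) such that for `t ∈ S₀` the parameter `u₀ t` is associated to the germ at `x` of the
centre generator `D.x (eS t)`, and for `t ∉ S₀` to the germ of the further coordinate
`D.w (eW t)`. [cite: StacksProject, Tag 0804] -/
theorem exists_chartData_of_rsop (hπ : IsBlowup π C) (x' : X') (hxC : π x' ∈ C.support)
    (hreg : IsRegularLocalRing (X.presheaf.stalk (π x')))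
    {d : ℕ} (hd : (maximalIdeal (X.presheaf.stalk (π x'))).spanFinrank = d)
    (u₀ : Fin d → X.presheaf.stalk (π x'))
    (hu₀ : Ideal.span (Set.range u₀) = maximalIdeal (X.presheaf.stalk (π x')))
    (S₀ : Finset (Fin d)) (hS₀ : stalkIdeal C (π x') = Ideal.span (u₀ '' (S₀ : Set (Fin d)))) :
    ∃ (D : ChartData π C x') (eS : S₀ ≃ Fin D.r) (eW : (S₀ᶜ : Finset (Fin d)) ≃ Fin D.a),
      (∀ t : S₀, Associated (u₀ t) ((X.presheaf.germ D.U (π x') D.hxU).hom (D.x (eS t)))) ∧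
      (∀ t : (S₀ᶜ : Finset (Fin d)),
        Associated (u₀ t) ((X.presheaf.germ D.U (π x') D.hxU).hom (D.w (eW t)))) := by
  have _ := hxC -- implied by `hS₀`; kept for the interface (cf. `ChartData.stalkIdeal_exceptional`)
  -- an affine open and sections with associated germs
  obtain ⟨U₁, hU₁, hxU₁, -⟩ :=
    exists_isAffineOpen_mem_and_subset (X := X) (x := π x') (U := ⊤) (Opens.mem_top _)
  obtain ⟨sec, hsec⟩ := exists_sections_associated (X := X) ⟨U₁, hU₁⟩ hxU₁ u₀
  set u₁ : Fin d → X.presheaf.stalk (π x') :=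
    fun t => (X.presheaf.germ U₁ (π x') hxU₁).hom (sec t) with hu₁def
  have hu₁span : Ideal.span (Set.range u₁) = maximalIdeal _ :=
    (Ideal.span_range_eq_of_associated hsec).symm.trans hu₀
  -- enumerations of `S₀` and of its complement
  set enumS : Fin S₀.card → Fin d := fun l => (S₀.equivFin.symm l).1 with henumS
  set enumW : Fin S₀ᶜ.card → Fin d := fun m => (S₀ᶜ.equivFin.symm m).1 with henumW
  have henumS_mem : ∀ l, enumS l ∈ S₀ := fun l => (S₀.equivFin.symm l).2
  have henumS_inj : Function.Injective enumS := fun l l' h =>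
    S₀.equivFin.symm.injective (Subtype.ext h)
  -- the stalk of `C` is generated by the `u₁ ∘ enumS`
  have hrangeS : Set.range (u₁ ∘ enumS) = u₁ '' (S₀ : Set (Fin d)) := by
    ext y
    constructor
    · rintro ⟨l, rfl⟩
      exact ⟨enumS l, henumS_mem l, rfl⟩
    · rintro ⟨t, ht, rfl⟩
      exact ⟨S₀.equivFin ⟨t, ht⟩, by simp [henumS]⟩
  have hCst : stalkIdeal C (π x') =
      Ideal.span (Set.range fun l => (X.presheaf.germ U₁ (π x') hxU₁).hom (sec (enumS l))) := by
    rw [hS₀, span_image_eq_of_associated hsec (S₀ : Set (Fin d)), ← hrangeS]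
    rfl
  have hrsop : IsRsopPart fun l => (X.presheaf.germ U₁ (π x') hxU₁).hom (sec (enumS l)) :=
    isRsopPart_comp_of_rsop hd u₁ hu₁span enumS henumS_inj
  obtain ⟨g, hxg, hspanC, hqr⟩ :=
    exists_basicOpen_span_eq_isQuasiRegular ⟨U₁, hU₁⟩ hxU₁ C (fun l => sec (enumS l)) hCst hrsop
  -- the affine open `U = D(g)` and the sections restricted to it
  have hxU : π x' ∈ ((X.affineBasicOpen (U := ⟨U₁, hU₁⟩) g : X.affineOpens) : X.Opens) := hxg
  have hgerm : ∀ s : Γ(X, U₁),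
      (X.presheaf.germ (X.affineBasicOpen (U := ⟨U₁, hU₁⟩) g) (π x') hxU).hom
        ((X.presheaf.map (homOfLE (X.basicOpen_le g)).op).hom s) =
      (X.presheaf.germ U₁ (π x') hxU₁).hom s := fun s =>
    TopCat.Presheaf.germ_res_apply X.presheaf _ _ _ s
  obtain ⟨i, V, hVU, e, hx'V, he⟩ := hπ.exists_generator_chart _ hxU _ hspanC
  -- the dimension count and the regular system of parameters
  have hdD : (maximalIdeal (X.presheaf.stalk (π x'))).spanFinrank = S₀.card + S₀ᶜ.card := by
    rw [Finset.card_add_card_compl, Fintype.card_fin]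
    exact hd
  have hu : Ideal.span (Set.range (Fin.append
      (fun j => (X.presheaf.germ (X.affineBasicOpen (U := ⟨U₁, hU₁⟩) g) (π x') hxU).hom
        ((X.presheaf.map (homOfLE (X.basicOpen_le g)).op).hom (sec (enumS j))))
      (fun m => (X.presheaf.germ (X.affineBasicOpen (U := ⟨U₁, hU₁⟩) g) (π x') hxU).hom
        ((X.presheaf.map (homOfLE (X.basicOpen_le g)).op).hom (sec (enumW m)))))) =
      maximalIdeal (X.presheaf.stalk (π x')) := by
    refine Eq.trans ?_ hu₁span
    congr 1
    ext y
    constructor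
    · rintro ⟨k, rfl⟩
      induction k using Fin.addCases with
      | left j => exact ⟨enumS j, by rw [Fin.append_left, hgerm]⟩
      | right m => exact ⟨enumW m, by rw [Fin.append_right, hgerm]⟩
    · rintro ⟨t, rfl⟩
      by_cases ht : t ∈ S₀
      · refine ⟨Fin.castAdd _ (S₀.equivFin ⟨t, ht⟩), ?_⟩
        rw [Fin.append_left, hgerm]
        simp [hu₁def, henumS]
      · refine ⟨Fin.natAdd _ (S₀ᶜ.equivFin ⟨t, Finset.mem_compl.mpr ht⟩), ?_⟩
        rw [Fin.append_right, hgerm]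
        simp [hu₁def, henumW]
  let D : ChartData π C x' :=
    { U := X.affineBasicOpen (U := ⟨U₁, hU₁⟩) g
      hxU := hxU
      r := S₀.card
      a := S₀ᶜ.card
      x := fun l => (X.presheaf.map (homOfLE (X.basicOpen_le g)).op).hom (sec (enumS l))
      w := fun m => (X.presheaf.map (homOfLE (X.basicOpen_le g)).op).hom (sec (enumW m))
      hqr := hqr
      hspanC := hspanC
      i := i
      V := V
      hVU := hVU
      hx'V := hx'V
      e := e
      he := he
      hreg := hreg
      hd := hdD
      hu := hu }
  -- the associatedness of the given parameters with the germs of the chart sections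
  have hassS : ∀ t : S₀, Associated (u₀ t)
      ((X.presheaf.germ (X.affineBasicOpen (U := ⟨U₁, hU₁⟩) g) (π x') hxU).hom
        ((X.presheaf.map (homOfLE (X.basicOpen_le g)).op).hom (sec (enumS (S₀.equivFin t))))) := by
    intro t
    rw [hgerm]
    simpa [hu₁def, henumS] using hsec t
  have hassW : ∀ t : (S₀ᶜ : Finset (Fin d)), Associated (u₀ t)
      ((X.presheaf.germ (X.affineBasicOpen (U := ⟨U₁, hU₁⟩) g) (π x') hxU).hom
        ((X.presheaf.map (homOfLE (X.basicOpen_le g)).op).hom (sec (enumW (S₀ᶜ.equivFin t))))) := by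
    intro t
    rw [hgerm]
    simpa [hu₁def, henumW] using hsec t
  exact ⟨D, S₀.equivFin, S₀ᶜ.equivFin, hassS, hassW⟩

/-- **Chart data from a given regular system of parameters (enumeration form).** As
`exists_chartData_of_rsop`, but the identification is returned as injective enumerations
`σ : Fin D.r → Fin d` with range `S₀` and `σ' : Fin D.a → Fin d` with range the complement of
`S₀`, the parameter `u₀ (σ l)` being associated to the germ of the centre generator `D.x l` and
`u₀ (σ' m)` to the germ of the further coordinate `D.w m`. [cite: StacksProject, Tag 0804] -/
theorem exists_chartData_of_rsop' (hπ : IsBlowup π C) (x' : X') (hxC : π x' ∈ C.support)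
    (hreg : IsRegularLocalRing (X.presheaf.stalk (π x')))
    {d : ℕ} (hd : (maximalIdeal (X.presheaf.stalk (π x'))).spanFinrank = d)
    (u₀ : Fin d → X.presheaf.stalk (π x'))
    (hu₀ : Ideal.span (Set.range u₀) = maximalIdeal (X.presheaf.stalk (π x')))
    (S₀ : Finset (Fin d)) (hS₀ : stalkIdeal C (π x') = Ideal.span (u₀ '' (S₀ : Set (Fin d)))) :
    ∃ (D : ChartData π C x') (σ : Fin D.r → Fin d) (σ' : Fin D.a → Fin d),
      Function.Injective σ ∧ Function.Injective σ' ∧ Set.range σ = (S₀ : Set (Fin d)) ∧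
      Set.range σ' = (S₀ : Set (Fin d))ᶜ ∧
      (∀ l, Associated (u₀ (σ l)) ((X.presheaf.germ D.U (π x') D.hxU).hom (D.x l))) ∧
      (∀ m, Associated (u₀ (σ' m)) ((X.presheaf.germ D.U (π x') D.hxU).hom (D.w m))) := by
  obtain ⟨D, eS, eW, hS, hW⟩ := exists_chartData_of_rsop hπ x' hxC hreg hd u₀ hu₀ S₀ hS₀
  refine ⟨D, fun l => (eS.symm l).1, fun m => (eW.symm m).1,
    fun l l' h => eS.symm.injective (Subtype.ext h),
    fun m m' h => eW.symm.injective (Subtype.ext h), ?_, ?_, fun l => ?_, fun m => ?_⟩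
  · ext t
    constructor
    · rintro ⟨l, rfl⟩
      exact (eS.symm l).2
    · intro ht
      exact ⟨eS ⟨t, ht⟩, by simp⟩
  · ext t
    constructor
    · rintro ⟨m, rfl⟩
      exact Finset.mem_compl.mp (eW.symm m).2
    · intro ht
      exact ⟨eW ⟨t, Finset.mem_compl.mpr ht⟩, by simp⟩
  · simpa using hS (eS.symm l)
  · simpa using hW (eW.symm m)

/-- **The labels corollary** (the conclusion shape of `exists_chartData`): in the situation of
`exists_chartData_of_rsop`, if `K k` (`k : κ`) are ideal sheaves whose stalks at `π x'` are
generated by single parameters `u₀ (lab k)` with `lab` injective, then for the chart data `D`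
there is an injective assignment `τ` to each `k` of a centre generator `x_j` or a further
coordinate `w_m` whose germ generates the stalk of `K k` (together with the bijections `eS`,
`eW` of `exists_chartData_of_rsop` and the formula for `τ` in terms of them). With `κ` the
divisors of `E` through `π x'` and `u₀`, `lab`, `S₀` the data of `HasSNCWith E C` at `π x'` (the
set of positions made a finset) this recovers the conclusion of `exists_chartData`. [folklore] -/
theorem exists_chartData_labels_of_rsop (hπ : IsBlowup π C) (x' : X') (hxC : π x' ∈ C.support)
    (hreg : IsRegularLocalRing (X.presheaf.stalk (π x')))
    {d : ℕ} (hd : (maximalIdeal (X.presheaf.stalk (π x'))).spanFinrank = d)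
    (u₀ : Fin d → X.presheaf.stalk (π x'))
    (hu₀ : Ideal.span (Set.range u₀) = maximalIdeal (X.presheaf.stalk (π x')))
    (S₀ : Finset (Fin d)) (hS₀ : stalkIdeal C (π x') = Ideal.span (u₀ '' (S₀ : Set (Fin d))))
    {κ : Type v} {lab : κ → Fin d} (hlab : Function.Injective lab) (K : κ → X.IdealSheafData)
    (hK : ∀ k, stalkIdeal (K k) (π x') = Ideal.span {u₀ (lab k)}) :
    ∃ (D : ChartData π C x') (eS : S₀ ≃ Fin D.r) (eW : (S₀ᶜ : Finset (Fin d)) ≃ Fin D.a)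
      (τ : κ → Fin D.r ⊕ Fin D.a),
      (∀ t : S₀, Associated (u₀ t) ((X.presheaf.germ D.U (π x') D.hxU).hom (D.x (eS t)))) ∧
      (∀ t : (S₀ᶜ : Finset (Fin d)),
        Associated (u₀ t) ((X.presheaf.germ D.U (π x') D.hxU).hom (D.w (eW t)))) ∧
      Function.Injective τ ∧
      (∀ k (h : lab k ∈ S₀), τ k = Sum.inl (eS ⟨lab k, h⟩)) ∧
      (∀ k (h : lab k ∉ S₀), τ k = Sum.inr (eW ⟨lab k, Finset.mem_compl.mpr h⟩)) ∧
      ∀ k, stalkIdeal (K k) (π x') =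
        Ideal.span {Sum.elim (fun j => (X.presheaf.germ D.U (π x') D.hxU).hom (D.x j))
          (fun m => (X.presheaf.germ D.U (π x') D.hxU).hom (D.w m)) (τ k)} := by
  obtain ⟨D, eS, eW, hS, hW⟩ := exists_chartData_of_rsop hπ x' hxC hreg hd u₀ hu₀ S₀ hS₀
  let τ : κ → Fin D.r ⊕ Fin D.a := fun k =>
    if h : lab k ∈ S₀ then Sum.inl (eS ⟨lab k, h⟩) else Sum.inr (eW ⟨lab k, Finset.mem_compl.mpr h⟩)
  have hτS : ∀ k (h : lab k ∈ S₀), τ k = Sum.inl (eS ⟨lab k, h⟩) := fun k h => dif_pos h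
  have hτW : ∀ k (h : lab k ∉ S₀), τ k = Sum.inr (eW ⟨lab k, Finset.mem_compl.mpr h⟩) :=
    fun k h => dif_neg h
  refine ⟨D, eS, eW, τ, hS, hW, fun k k' hkk' => ?_, hτS, hτW, fun k => ?_⟩
  · apply hlab
    by_cases h : lab k ∈ S₀ <;> by_cases h' : lab k' ∈ S₀
    · rw [hτS k h, hτS k' h', Sum.inl.injEq] at hkk'
      exact congrArg Subtype.val (eS.injective hkk')
    · rw [hτS k h, hτW k' h'] at hkk'
      exact absurd hkk' Sum.inl_ne_inr
    · rw [hτW k h, hτS k' h'] at hkk'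
      exact absurd hkk' Sum.inr_ne_inl
    · rw [hτW k h, hτW k' h', Sum.inr.injEq] at hkk'
      exact congrArg Subtype.val (eW.injective hkk')
  · rw [hK k]
    by_cases h : lab k ∈ S₀
    · obtain ⟨w, hw⟩ := hS ⟨lab k, h⟩
      rw [hτS k h, Sum.elim_inl, ← hw, Ideal.span_singleton_mul_right_unit w.isUnit]
    · obtain ⟨w, hw⟩ := hW ⟨lab k, Finset.mem_compl.mpr h⟩
      rw [hτW k h, Sum.elim_inr, ← hw, Ideal.span_singleton_mul_right_unit w.isUnit]

end Literature.AlgebraicGeometry.Resolution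

end
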